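import Literature.Probability.Percolation.LongRangeSharpnessSupercritical
import Literature.Probability.Percolation.LongRangeSimonLieb
import HarnessLib

/-!
# Sharpness for long-range percolation, IV: finite susceptibility below `β_c`

Topic `Literature/Probability/Percolation`. Assembly of the Duminil-Copin–Tassion (CMP 343 (2016),
§1) proof of **sharpness of the phase transition for long-range percolation with a kernel `J` on
`ℤ^d`** in Hutchcroft's setting (`kernelPercolation J β`, `kernelCriticalBeta J`): for a
nonnegative, translation-invariant, integrable kernel and `0 ≤ β < β_c`,
`Σ_x ℙ_β(0 ↔ x) = E_β|K(0)| < ∞` (DCT Thm. 1.1, item 2; Aizenman–Barsky 1987). This is the input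
"the expected size of the cluster of the origin is finite for `β < β_c`
[aizenman1987sharpness, duminil2015new, 1901.10363]" of Hutchcroft 2022, Prop. 2.4 and Prop. 2.7.

Proof (DCT's `β̃_c = β_c`, arranged without naming `β̃_c`): if `0 ≤ β < β_c` there are `b > β` and
a finite `S ∋ 0` with `b ψ_b(S) < 1` — otherwise `b ψ_b(S) ≥ 1` for all `b > β` and all `S`, and
`LongRangeSharpnessSupercritical.lean` (DCT item 1) makes every `β₂ > β` percolate, forcing
`β_c ≤ β`; then `φ_β(S) ≤ φ_b(S) ≤ b ψ_b(S) < 1` and `LongRangeSimonLieb.lean` (DCT §1.4) bounds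
`Σ_{x ∈ Λ} ℙ_β(z ↔ x) ≤ |S|/(1 - φ_β(S))` uniformly in `Λ`.

* `kernelPhi_le_mul_kernelPsi` — `φ_β(S) ≤ β ψ_β(S)`;
* `exists_mul_kernelPsi_lt_one_of_lt_criticalBeta` — the mean-field criterion below `β_c`;
* **`exists_sum_real_openConn_le_of_lt_criticalBeta`**, **`summable_real_openConn_of_lt_criticalBeta`**.

## References

* [DuminilCopinTassionCMP2016] H. Duminil-Copin, V. Tassion, Comm. Math. Phys. 343 (2016)
  725–745, arXiv:1502.03050: Thm. 1.1 and §1 (proof of `β̃_c = β_c`).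
* [AizenmanBarsky1987] M. Aizenman, D. J. Barsky, Comm. Math. Phys. 108 (1987) 489–526.
* [Hutchcroft2022] T. Hutchcroft, J. Math. Phys. 63 (2022), arXiv:2202.07634, §2.2 p. 7,
  Prop. 2.4, Prop. 2.7.
-/

noncomputable section

namespace Literature.Probability.Percolation

open MeasureTheory Finset Literature.Probability.LatticeModels


section Sharpness

variable {d : ℕ}

/-- `φ_β(S) ≤ β ψ_β(S)` (`1 - e^{-t} ≤ t`). [cite: DuminilCopinTassionCMP2016, §1.1 (1.1)] -/
theorem kernelPhi_le_mul_kernelPsi {J : Sym2 (Site d) → ℝ} (hJ : ∀ e, 0 ≤ J e)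
    (hI : IsIntegrableKernel J) {β : ℝ} (hβ : 0 ≤ β) {S : Finset (Site d)} (h0 : (0 : Site d) ∈ S) :
    kernelPhi J β S ≤ β * kernelPsi J β S := by
  classical
  unfold kernelPhi kernelPsi
  rw [Finset.mul_sum]
  refine Finset.sum_le_sum fun y hy => ?_
  have hev : (openConnIn (↑S : Set (Site d)) 0 y : Set (BondConfig (Site d))) =
      {ω | IntConn S ω 0 y} := Set.ext fun ω => (intConn_iff_mem_openConnIn h0 ω y).symm
  rw [hev, ← mul_assoc]
  refine mul_le_mul_of_nonneg_right ?_ measureReal_nonneg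
  rw [← tsum_mul_left]
  refine Summable.tsum_le_tsum (fun w => ?_) (summable_kernelEdgeProb_exit hJ hI hβ S y)
    ((summable_kernel_indicator_compl hJ hI S y).mul_left β)
  split_ifs
  · simp
  · rw [coe_kernelEdgeProb (mul_nonneg hβ (hJ _))]
    have := Real.add_one_le_exp (-(β * J s(y, w)))
    linarith

/-- **The mean-field criterion is met below `β_c`**: if `0 ≤ β < β_c` then `b ψ_b(S) < 1` for some
`b > β` and some finite `S ∋ 0` (otherwise every `β₂ > β` percolates by
`one_sub_exp_le_real_percolatesAt`, forcing `β_c ≤ β`). This is "`β̃_c = β_c`" of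
Duminil-Copin–Tassion in the direction `β_c ≤ β̃_c`. [cite: DuminilCopinTassionCMP2016, §1.1 (proof of Thm. 1.1: β̃_c = β_c)] -/
theorem exists_mul_kernelPsi_lt_one_of_lt_criticalBeta {J : Sym2 (Site d) → ℝ} (hJ : ∀ e, 0 ≤ J e)
    (hI : IsIntegrableKernel J) {β : ℝ} (hβ : 0 ≤ β) (hβc : β < kernelCriticalBeta J) :
    ∃ b : ℝ, β < b ∧ ∃ S : Finset (Site d), (0 : Site d) ∈ S ∧ b * kernelPsi J b S < 1 := by
  by_contra hcon
  push Not at hcon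
  -- every `β₂ > β` percolates
  have hperc : ∀ β₂ : ℝ, β < β₂ → 0 < (kernelPercolation J β₂).real (percolatesAt (0 : Site d)) := by
    intro β₂ hβ₂
    obtain ⟨β₁, hβ₁, h12⟩ := exists_between hβ₂
    have hβ₁0 : 0 < β₁ := lt_of_le_of_lt hβ hβ₁
    have H : ∀ b ∈ Set.Icc β₁ β₂, ∀ S : Finset (Site d), (0 : Site d) ∈ S → 1 / b ≤ kernelPsi J b S := by
      intro b hb S h0S
      have hb0 : 0 < b := lt_of_lt_of_le hβ₁0 hb.1
      have := hcon b (lt_of_lt_of_le hβ₁ hb.1) S h0S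
      rw [div_le_iff₀ hb0]
      linarith [mul_comm b (kernelPsi J b S)]
    refine lt_of_lt_of_le ?_ (one_sub_exp_le_real_percolatesAt hJ hI hβ₁0 h12.le H)
    have : Real.exp (-((β₂ - β₁) / β₂)) < 1 := Real.exp_lt_one_iff.2 (by
      rw [neg_lt_zero]; exact div_pos (by linarith) (by linarith))
    linarith
  -- hence `β_c ≤ β₂` for every `β₂ > β`, so `β_c ≤ β`
  have hle : ∀ β₂ : ℝ, β < β₂ → kernelCriticalBeta J ≤ β₂ := by
    intro β₂ hβ₂
    refine csInf_le ⟨0, fun b hb => hb.1⟩ ⟨by linarith, lt_of_lt_of_le (hperc β₂ hβ₂) ?_⟩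
    exact measureReal_mono (fun ω hω => ⟨0, hω⟩) (measure_ne_top _ _)
  have : kernelCriticalBeta J ≤ β := le_of_forall_gt_imp_ge_of_dense hle
  linarith

/-- **Sharpness of the phase transition for long-range percolation — finite susceptibility below
`β_c`** (Duminil-Copin–Tassion 2016, Thm. 1.1, item 2: "For `β < β_c`, the susceptibility is
finite"; Aizenman–Barsky 1987; the input "[duminil2015new, 1901.10363, aizenman1987sharpness]" of
Hutchcroft 2022, Prop. 2.4 and Prop. 2.7). For a nonnegative, translation-invariant, integrable
kernel on `ℤ^d` and `0 ≤ β < β_c`: there is `C < ∞` with `Σ_{x ∈ Λ} ℙ_β(z ↔ x) ≤ C` for every finite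
`Λ` and every `z`. [cite: DuminilCopinTassionCMP2016, Thm. 1.1 (item 2)] -/
theorem exists_sum_real_openConn_le_of_lt_criticalBeta {J : Sym2 (Site d) → ℝ} (hJ : ∀ e, 0 ≤ J e)
    (hT : IsTranslationInvariantKernel J) (hI : IsIntegrableKernel J) {β : ℝ} (hβ : 0 ≤ β)
    (hβc : β < kernelCriticalBeta J) :
    ∃ C : ℝ, ∀ (Λ : Finset (Site d)) (z : Site d),
      ∑ x ∈ Λ, (kernelPercolation J β).real (openConn z x) ≤ C := by
  obtain ⟨b, hβb, S, h0, hbS⟩ := exists_mul_kernelPsi_lt_one_of_lt_criticalBeta hJ hI hβ hβc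
  have hb : 0 ≤ b := hβ.trans hβb.le
  have hφ : kernelPhi J β S < 1 :=
    calc kernelPhi J β S ≤ kernelPhi J b S := kernelPhi_mono hJ hI hβ hβb.le S
      _ ≤ b * kernelPsi J b S := kernelPhi_le_mul_kernelPsi hJ hI hb h0
      _ < 1 := hbS
  exact ⟨S.card / (1 - kernelPhi J β S), fun Λ z =>
    kernelPercolation_sum_real_openConn_le hJ hT hI hβ h0 hφ Λ z⟩

/-- **Summability of the two-point function below `β_c`**: `Σ_x ℙ_β(0 ↔ x) < ∞` for `0 ≤ β < β_c`,
i.e. `E_β|K(0)| < ∞` ("the expected size of the cluster of the origin is finite for `β < β_c`",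
Hutchcroft 2022, p. 7). [cite: DuminilCopinTassionCMP2016, Thm. 1.1 (item 2)] -/
theorem summable_real_openConn_of_lt_criticalBeta {J : Sym2 (Site d) → ℝ} (hJ : ∀ e, 0 ≤ J e)
    (hT : IsTranslationInvariantKernel J) (hI : IsIntegrableKernel J) {β : ℝ} (hβ : 0 ≤ β)
    (hβc : β < kernelCriticalBeta J) (z : Site d) :
    Summable fun x : Site d => (kernelPercolation J β).real (openConn z x) := by
  obtain ⟨C, hC⟩ := exists_sum_real_openConn_le_of_lt_criticalBeta hJ hT hI hβ hβc
  exact summable_of_sum_le (fun x => measureReal_nonneg) fun Λ => hC Λ z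

end Sharpness

end Literature.Probability.Percolation

end
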